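import Summits.AtomisticToContinuum.HydrodynamicLimit.Theorems.ImplosionDichotomyPolynomialCompressionUniquenessPrimitive

/-!
# The difference of two hard-sphere Euler solutions solves the frozen-coefficient linearised
system with an explicit right-hand side (blueprint §0 of stub 4)

Helper file for the line `log-lipschitz-budget` of the crux `ImplosionDichotomy.PolynomialCompression`
(stmt-AtomisticToContinuum-12587), stub `stub_logBudgetShadowing`. For a classical solution
`V = (ρ, u, θ)` with pressure law `ρ θ ζ(ρ)` and a second classical solution `V' = (ρ', u', θ')` on the
same `[0, T) × 𝕋³` with a possibly DIFFERENT law `ρ' θ' ζ₂(ρ')` (in the application: `ζ = Z(·σ³)`, the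
hard-sphere law, and `ζ₂ ≡ 1`, the ideal-gas reference), the difference `δV = V − V'` satisfies,
pointwise, the linear system with coefficients FROZEN AT `V` — exactly the operator
`P_V = (F_ρ, F_u, F_θ)` of `hsEuler_frozen_energy_identity` —
with the explicit right-hand sides

* `F_ρ(δV) = −δρ · div u' − δu · ∇ρ'`,
* `F_u(δV)ⱼ = −δu · ∇u'ⱼ − (θγ(ρ)/ρ − θ'γ₂(ρ')/ρ') ∂ⱼρ' − (ζ(ρ) − ζ₂(ρ')) ∂ⱼθ'`,
* `F_θ(δV) = −δu · ∇θ' − (2/3)(θζ(ρ) − θ'ζ₂(ρ')) div u'`,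

`γ = ζ + id·ζ'`, `γ₂ = ζ₂ + id·ζ₂'` (pure algebra on the primitive equations
`hsEuler_density_eq` / `hsEuler_velocity_eq` / `hsEuler_temperature_eq` of both solutions). The terms
carrying `ζ(ρ) − ζ₂(ρ')`, `γ(ρ) − γ₂(ρ')` are the equation-of-state defect (the forcing of the
shadowing estimate); everything else is linear in `δV` with reference-gradient coefficients.
-/

noncomputable section

namespace Summit.AtomisticToContinuum.HydrodynamicLimit.Theorems

open Set Filter Topology MeasureTheory
open scoped ContDiff
open Literature.MathematicalPhysics.KineticTheory Literature.Analysis.FunctionSpaces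

section Difference

variable {T : ℝ}

/-- Linearity of the one-sided time derivative on differences of jointly smooth scalar fields.
[folklore] -/
theorem timeDerivWithin_sub_fields {a b : ℝ → T3 → ℝ} (ha : Torus.IsSmoothSpaceTimeOn (Ico 0 T) a)
    (hb : Torus.IsSmoothSpaceTimeOn (Ico 0 T) b) {t : ℝ} (ht : t ∈ Ico 0 T) (x : T3) :
    Torus.timeDerivWithin (Ico 0 T) (fun s y => a s y - b s y) t x =
      Torus.timeDerivWithin (Ico 0 T) a t x - Torus.timeDerivWithin (Ico 0 T) b t x :=
  timeDerivWithin_eq_of_hasDerivWithinAt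
    ((ha.hasDerivWithinAt_slice ht x).sub (hb.hasDerivWithinAt_slice ht x))
    (uniqueDiffOn_Ico 0 T t ht)

/-- Linearity of the torus partial derivative on differences of `C¹` scalar functions. [folklore] -/
theorem partialDeriv_sub_fields {a b : T3 → ℝ} (ha : Torus.IsContDiff 1 a) (hb : Torus.IsContDiff 1 b)
    (i : Fin 3) (x : T3) :
    Torus.partialDeriv i (fun y => a y - b y) x = Torus.partialDeriv i a x - Torus.partialDeriv i b x :=
  partialDeriv_eq_of_hasDerivAt ((hasDerivAt_coordLine ha x i).sub (hasDerivAt_coordLine hb x i))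

/-- **Density component of the difference system.** With `δρ = ρ − ρ'`, `δu = u − u'`:
`∂ₜδρ + u·∇δρ + ρ div δu = −δρ div u' − δu·∇ρ'` pointwise on `[0, T) × 𝕋³`. [folklore] -/
theorem hsEuler_difference_density :
    ∀ {σ σ' T : ℝ} {ρ θ ρ' θ' : ℝ → T3 → ℝ} {u u' : ℝ → T3 → V3},
      IsHardSphereEulerSolution σ T ρ u θ → IsHardSphereEulerSolution σ' T ρ' u' θ' →
      ∀ {t : ℝ}, t ∈ Ico 0 T → ∀ x : T3,
        Torus.timeDerivWithin (Ico 0 T) (fun s y => ρ s y - ρ' s y) t x +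
            ∑ i, u t x i * Torus.partialDeriv i (fun y => ρ t y - ρ' t y) x +
            ρ t x * ∑ i, Torus.partialDeriv i (fun y => u t y i - u' t y i) x =
          -((ρ t x - ρ' t x) * ∑ i, Torus.partialDeriv i (fun y => u' t y i) x) -
            ∑ i, (u t x i - u' t x i) * Torus.partialDeriv i (ρ' t) x := by
  intro σ σ' T ρ θ ρ' θ' u u' hE hE' t ht x
  have hρ1 : Torus.IsContDiff 1 (ρ t) := (hE.smooth_density.isSmooth_slice ht).isContDiff (by simp)
  have hρ1' : Torus.IsContDiff 1 (ρ' t) := (hE'.smooth_density.isSmooth_slice ht).isContDiff (by simp)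
  have hu1 : Torus.IsContDiff 1 (u t) := (hE.smooth_velocity.isSmooth_slice ht).isContDiff (by simp)
  have hu1' : Torus.IsContDiff 1 (u' t) := (hE'.smooth_velocity.isSmooth_slice ht).isContDiff (by simp)
  have huj1 : ∀ i, Torus.IsContDiff 1 (fun y => u t y i) := fun i => isContDiff_apply_coord hu1 i
  have huj1' : ∀ i, Torus.IsContDiff 1 (fun y => u' t y i) := fun i => isContDiff_apply_coord hu1' i
  rw [timeDerivWithin_sub_fields hE.smooth_density hE'.smooth_density ht x,
    hsEuler_density_eq hE ht x, hsEuler_density_eq hE' ht x]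
  have h1 : ∀ i, Torus.partialDeriv i (fun y => ρ t y - ρ' t y) x =
      Torus.partialDeriv i (ρ t) x - Torus.partialDeriv i (ρ' t) x :=
    fun i => partialDeriv_sub_fields hρ1 hρ1' i x
  have h2 : ∀ i, Torus.partialDeriv i (fun y => u t y i - u' t y i) x =
      Torus.partialDeriv i (fun y => u t y i) x - Torus.partialDeriv i (fun y => u' t y i) x :=
    fun i => partialDeriv_sub_fields (huj1 i) (huj1' i) i x
  simp only [h1, h2, Fin.sum_univ_three]
  ring

/-- **Velocity component of the difference system.** With the pressure laws `ρθζ(ρ)` and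
`ρ'θ'ζ₂(ρ')`, `γ = ζ + id·ζ'`, `γ₂ = ζ₂ + id·ζ₂'`:
`∂ₜδuⱼ + u·∇δuⱼ + (θγ(ρ)/ρ)∂ⱼδρ + ζ(ρ)∂ⱼδθ = −δu·∇u'ⱼ − (θγ(ρ)/ρ − θ'γ₂(ρ')/ρ')∂ⱼρ' − (ζ(ρ) − ζ₂(ρ'))∂ⱼθ'`
pointwise on `[0, T) × 𝕋³`. [folklore] -/
theorem hsEuler_difference_velocity :
    ∀ {σ σ' T : ℝ} {ρ θ ρ' θ' : ℝ → T3 → ℝ} {u u' : ℝ → T3 → V3} {ζ ζ₂ : ℝ → ℝ} {J J₂ : Set ℝ},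
      IsHardSphereEulerSolution σ T ρ u θ → IsHardSphereEulerSolution σ' T ρ' u' θ' → IsOpen J →
      ContDiffOn ℝ (⊤ : ℕ∞) ζ J → (∀ t ∈ Ico 0 T, ∀ x, ρ t x ∈ J) →
      (∀ t ∈ Ico 0 T, ∀ x, hsPressure σ (ρ t x) (θ t x) = ρ t x * θ t x * ζ (ρ t x)) →
      IsOpen J₂ → ContDiffOn ℝ (⊤ : ℕ∞) ζ₂ J₂ → (∀ t ∈ Ico 0 T, ∀ x, ρ' t x ∈ J₂) →
      (∀ t ∈ Ico 0 T, ∀ x, hsPressure σ' (ρ' t x) (θ' t x) = ρ' t x * θ' t x * ζ₂ (ρ' t x)) →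
      ∀ {t : ℝ}, t ∈ Ico 0 T → ∀ (x : T3) (j : Fin 3),
        Torus.timeDerivWithin (Ico 0 T) (fun s y => u s y j - u' s y j) t x +
            ∑ i, u t x i * Torus.partialDeriv i (fun y => u t y j - u' t y j) x +
            θ t x * (ζ (ρ t x) + ρ t x * deriv ζ (ρ t x)) / ρ t x *
              Torus.partialDeriv j (fun y => ρ t y - ρ' t y) x +
            ζ (ρ t x) * Torus.partialDeriv j (fun y => θ t y - θ' t y) x =
          -(∑ i, (u t x i - u' t x i) * Torus.partialDeriv i (fun y => u' t y j) x) -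
            (θ t x * (ζ (ρ t x) + ρ t x * deriv ζ (ρ t x)) / ρ t x -
                θ' t x * (ζ₂ (ρ' t x) + ρ' t x * deriv ζ₂ (ρ' t x)) / ρ' t x) *
              Torus.partialDeriv j (ρ' t) x -
            (ζ (ρ t x) - ζ₂ (ρ' t x)) * Torus.partialDeriv j (θ' t) x := by
  intro σ σ' T ρ θ ρ' θ' u u' ζ ζ₂ J J₂ hE hE' hJ hζ hρJ hp hJ₂ hζ₂ hρJ₂ hp' t ht x j
  have hU : UniqueDiffOn ℝ (Ico (0 : ℝ) T) := uniqueDiffOn_Ico 0 T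
  have hρ1 : Torus.IsContDiff 1 (ρ t) := (hE.smooth_density.isSmooth_slice ht).isContDiff (by simp)
  have hρ1' : Torus.IsContDiff 1 (ρ' t) := (hE'.smooth_density.isSmooth_slice ht).isContDiff (by simp)
  have hθ1 : Torus.IsContDiff 1 (θ t) := (hE.smooth_temperature.isSmooth_slice ht).isContDiff (by simp)
  have hθ1' : Torus.IsContDiff 1 (θ' t) :=
    (hE'.smooth_temperature.isSmooth_slice ht).isContDiff (by simp)
  have hu1 : Torus.IsContDiff 1 (u t) := (hE.smooth_velocity.isSmooth_slice ht).isContDiff (by simp)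
  have hu1' : Torus.IsContDiff 1 (u' t) := (hE'.smooth_velocity.isSmooth_slice ht).isContDiff (by simp)
  have huj1 : ∀ i, Torus.IsContDiff 1 (fun y => u t y i) := fun i => isContDiff_apply_coord hu1 i
  have huj1' : ∀ i, Torus.IsContDiff 1 (fun y => u' t y i) := fun i => isContDiff_apply_coord hu1' i
  -- linearity of the derivatives of the differences
  have hT : Torus.timeDerivWithin (Ico 0 T) (fun s y => u s y j - u' s y j) t x =
      Torus.timeDerivWithin (Ico 0 T) (fun s y => u s y j) t x -
        Torus.timeDerivWithin (Ico 0 T) (fun s y => u' s y j) t x :=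
    timeDerivWithin_sub_fields (hE.smooth_velocity.apply j) (hE'.smooth_velocity.apply j) ht x
  have h1 : ∀ i, Torus.partialDeriv i (fun y => u t y j - u' t y j) x =
      Torus.partialDeriv i (fun y => u t y j) x - Torus.partialDeriv i (fun y => u' t y j) x :=
    fun i => partialDeriv_sub_fields (huj1 j) (huj1' j) i x
  have h2 : Torus.partialDeriv j (fun y => ρ t y - ρ' t y) x =
      Torus.partialDeriv j (ρ t) x - Torus.partialDeriv j (ρ' t) x :=
    partialDeriv_sub_fields hρ1 hρ1' j x
  have h3 : Torus.partialDeriv j (fun y => θ t y - θ' t y) x =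
      Torus.partialDeriv j (θ t) x - Torus.partialDeriv j (θ' t) x :=
    partialDeriv_sub_fields hθ1 hθ1' j x
  -- the two momentum equations (primitive form), divided by the densities
  have hρpos : 0 < ρ t x := hE.density_pos t ht x
  have hρpos' : 0 < ρ' t x := hE'.density_pos t ht x
  have hV := hsEuler_velocity_eq hE hJ hζ hρJ hp ht x j
  have hV' := hsEuler_velocity_eq hE' hJ₂ hζ₂ hρJ₂ hp' ht x j
  have hVd : Torus.timeDerivWithin (Ico 0 T) (fun s y => u s y j) t x =
      (-(ρ t x * ∑ i, u t x i * Torus.partialDeriv i (fun y => u t y j) x) -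
        (θ t x * (ζ (ρ t x) + ρ t x * deriv ζ (ρ t x)) * Torus.partialDeriv j (ρ t) x +
          ρ t x * ζ (ρ t x) * Torus.partialDeriv j (θ t) x)) / ρ t x := by
    rw [eq_div_iff hρpos.ne', mul_comm]; exact hV
  have hVd' : Torus.timeDerivWithin (Ico 0 T) (fun s y => u' s y j) t x =
      (-(ρ' t x * ∑ i, u' t x i * Torus.partialDeriv i (fun y => u' t y j) x) -
        (θ' t x * (ζ₂ (ρ' t x) + ρ' t x * deriv ζ₂ (ρ' t x)) * Torus.partialDeriv j (ρ' t) x +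
          ρ' t x * ζ₂ (ρ' t x) * Torus.partialDeriv j (θ' t) x)) / ρ' t x := by
    rw [eq_div_iff hρpos'.ne', mul_comm]; exact hV'
  rw [hT, hVd, hVd', h2, h3]
  simp only [h1, Fin.sum_univ_three]
  field_simp
  ring

/-- **Temperature component of the difference system.**
`∂ₜδθ + u·∇δθ + (2/3)θζ(ρ) div δu = −δu·∇θ' − (2/3)(θζ(ρ) − θ'ζ₂(ρ')) div u'` pointwise on
`[0, T) × 𝕋³`. [folklore] -/
theorem hsEuler_difference_temperature :
    ∀ {σ σ' T : ℝ} {ρ θ ρ' θ' : ℝ → T3 → ℝ} {u u' : ℝ → T3 → V3} {ζ ζ₂ : ℝ → ℝ} {J J₂ : Set ℝ},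
      IsHardSphereEulerSolution σ T ρ u θ → IsHardSphereEulerSolution σ' T ρ' u' θ' → IsOpen J →
      ContDiffOn ℝ (⊤ : ℕ∞) ζ J → (∀ t ∈ Ico 0 T, ∀ x, ρ t x ∈ J) →
      (∀ t ∈ Ico 0 T, ∀ x, hsPressure σ (ρ t x) (θ t x) = ρ t x * θ t x * ζ (ρ t x)) →
      IsOpen J₂ → ContDiffOn ℝ (⊤ : ℕ∞) ζ₂ J₂ → (∀ t ∈ Ico 0 T, ∀ x, ρ' t x ∈ J₂) →
      (∀ t ∈ Ico 0 T, ∀ x, hsPressure σ' (ρ' t x) (θ' t x) = ρ' t x * θ' t x * ζ₂ (ρ' t x)) →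
      ∀ {t : ℝ}, t ∈ Ico 0 T → ∀ x : T3,
        Torus.timeDerivWithin (Ico 0 T) (fun s y => θ s y - θ' s y) t x +
            ∑ i, u t x i * Torus.partialDeriv i (fun y => θ t y - θ' t y) x +
            2 / 3 * (θ t x * ζ (ρ t x)) * ∑ i, Torus.partialDeriv i (fun y => u t y i - u' t y i) x =
          -(∑ i, (u t x i - u' t x i) * Torus.partialDeriv i (θ' t) x) -
            2 / 3 * (θ t x * ζ (ρ t x) - θ' t x * ζ₂ (ρ' t x)) *
              ∑ i, Torus.partialDeriv i (fun y => u' t y i) x := by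
  intro σ σ' T ρ θ ρ' θ' u u' ζ ζ₂ J J₂ hE hE' hJ hζ hρJ hp hJ₂ hζ₂ hρJ₂ hp' t ht x
  have hθ1 : Torus.IsContDiff 1 (θ t) := (hE.smooth_temperature.isSmooth_slice ht).isContDiff (by simp)
  have hθ1' : Torus.IsContDiff 1 (θ' t) :=
    (hE'.smooth_temperature.isSmooth_slice ht).isContDiff (by simp)
  have hu1 : Torus.IsContDiff 1 (u t) := (hE.smooth_velocity.isSmooth_slice ht).isContDiff (by simp)
  have hu1' : Torus.IsContDiff 1 (u' t) := (hE'.smooth_velocity.isSmooth_slice ht).isContDiff (by simp)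
  have huj1 : ∀ i, Torus.IsContDiff 1 (fun y => u t y i) := fun i => isContDiff_apply_coord hu1 i
  have huj1' : ∀ i, Torus.IsContDiff 1 (fun y => u' t y i) := fun i => isContDiff_apply_coord hu1' i
  rw [timeDerivWithin_sub_fields hE.smooth_temperature hE'.smooth_temperature ht x,
    hsEuler_temperature_eq hE hJ hζ hρJ hp ht x, hsEuler_temperature_eq hE' hJ₂ hζ₂ hρJ₂ hp' ht x]
  have h1 : ∀ i, Torus.partialDeriv i (fun y => θ t y - θ' t y) x =
      Torus.partialDeriv i (θ t) x - Torus.partialDeriv i (θ' t) x :=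
    fun i => partialDeriv_sub_fields hθ1 hθ1' i x
  have h2 : ∀ i, Torus.partialDeriv i (fun y => u t y i - u' t y i) x =
      Torus.partialDeriv i (fun y => u t y i) x - Torus.partialDeriv i (fun y => u' t y i) x :=
    fun i => partialDeriv_sub_fields (huj1 i) (huj1' i) i x
  simp only [h1, h2, Fin.sum_univ_three]
  ring

end Difference

end Summit.AtomisticToContinuum.HydrodynamicLimit.Theorems

end
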